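import Mathlib
import HarnessLib
import Summits.QuantumFields.YangMills.Theorems.ComplexCouplingChannelContinuumLegGivenGapAlternatingArraysDefs

/-!
# Bookkeeping of the alternating grid (crux `ContinuumLegGivenGap`, stmt-QuantumFields-15828,
# line `alternating-curvature-arrays`, helper of `stub_arrayFunctional`)

Pure arithmetic of the dihedral transport `cellMap` / `cornerMap` of
`…ContinuumLegGivenGapAlternatingArraysDefs` on an admissible level (`3^(m+1) ∣ 2L+1`, `N = numCells L m` cells per
axis, `3^m · N = 2 (2L+1)`), in DOUBLED coordinates (no division): the transport at the home cell is the identity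
(`cornerMap_self`); indices congruent mod `N` transport to sites congruent mod `2L+1` (`cellMap_intCast_congr`); the
wall reflection `t ↦ 2v + 3^m c - t` of a corner transported to cell `b'` is the corner transported to the reflected
cell `b`, `b + b' ≡ 2c - 1 (mod N)`, INCLUDING the in-plane shift `-e_μ` (`cellMap_reflect`); transported core sites
stay two lattice units inside their cell (`two_mul_cellMap_bounds`, `two_mul_cornerMap_bounds`) and hence strictly
between the wall `c` and its antipode when the cell lies in the positive half (`exists_slab_lift`); distinct home
cells of the central half-box are distinct mod `N` (`eq_of_cellInHalfBox_of_intCast_eq`); and the core support in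
lattice units (`two_mul_bounds_of_mem_physCore`).  Everything is elementary. [folklore]
-/

set_option autoImplicit false

noncomputable section

namespace Summit.QuantumFields.YangMills.Theorems.ContinuumLegGivenGap

open Summit.QuantumFields.YangMills.Theorems.ContinuumLegGivenGap.AlternatingArrays
open Summit.QuantumFields.YangMills.Cruxes.ContinuumLimitOnTrajectory.TwoOrbitSynchronisation (PlaqIdx)
open Literature.MathematicalPhysics.QuantumLattice (siteToE siteToE_apply)

/-! ## The admissible level -/

/-- On an admissible level, `3^m · numCells = 2 (2L+1)`, `numCells` is even and at least `6`. [folklore] -/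
theorem numCells_spec {L m : ℕ} (h : LevelAdmissible L m) :
    3 ^ m * numCells L m = 2 * (2 * L + 1) ∧ Even (numCells L m) ∧ 6 ≤ numCells L m := by
  obtain ⟨u, hu⟩ := h
  have hu0 : 0 < u := Nat.pos_of_ne_zero fun h0 => by subst h0; simp at hu
  have hN : numCells L m = 2 * (3 * u) := by
    unfold numCells
    rw [hu, pow_succ, show 2 * (3 ^ m * 3 * u) = 3 ^ m * (2 * (3 * u)) by ring,
      Nat.mul_div_cancel_left _ (pow_pos (by norm_num) m)]
  refine ⟨?_, ⟨3 * u, by omega⟩, by omega⟩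
  rw [hN, hu, pow_succ]; ring

/-- The same in `ℤ`: `3^m · N = 2 (2L+1)`. [folklore] -/
theorem numCells_spec_int {L m : ℕ} (h : LevelAdmissible L m) :
    (3 : ℤ) ^ m * (numCells L m : ℕ) = 2 * ((2 * L + 1 : ℕ) : ℤ) := by
  have h1 := (numCells_spec h).1
  exact_mod_cast h1

/-! ## The transport in doubled coordinates -/

/-- Even case of `cellMap`, doubled: `2 · cellMap = 2t + 3^m (z - z₀)`. [folklore] -/
theorem two_mul_cellMap_of_even (m : ℕ) (v z₀ z t : ℤ) (h : Even (z - z₀)) :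
    2 * cellMap m v z₀ z t = 2 * t + 3 ^ m * z - 3 ^ m * z₀ := by
  obtain ⟨k, hk⟩ := h
  rw [cellMap, if_pos ⟨k, hk⟩, hk, show (3 : ℤ) ^ m * (k + k) = 2 * (3 ^ m * k) by ring,
    Int.mul_ediv_cancel_left _ two_ne_zero]
  linear_combination (-(3 : ℤ) ^ m) * hk

/-- Odd case of `cellMap`, doubled: `2 · cellMap = 4v + 3^m (z + z₀ + 1) - 2t`. [folklore] -/
theorem two_mul_cellMap_of_not_even (m : ℕ) (v z₀ z t : ℤ) (h : ¬ Even (z - z₀)) :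
    2 * cellMap m v z₀ z t = 4 * v + 3 ^ m * z + 3 ^ m * z₀ + 3 ^ m - 2 * t := by
  have h' := h
  rw [Int.not_even_iff_odd] at h'
  obtain ⟨k, hk⟩ := h'
  have hz : z + z₀ + 1 = 2 * (k + z₀ + 1) := by linarith
  rw [cellMap, if_neg h, hz, show (3 : ℤ) ^ m * (2 * (k + z₀ + 1)) = 2 * (3 ^ m * (k + z₀ + 1)) by ring,
    Int.mul_ediv_cancel_left _ two_ne_zero]
  linear_combination (-(3 : ℤ) ^ m) * hk

/-- At the home cell the transport of a coordinate is the identity. [folklore] -/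
theorem cellMap_self (m : ℕ) (v z₀ t : ℤ) : cellMap m v z₀ z₀ t = t := by
  have h := two_mul_cellMap_of_even m v z₀ z₀ t (by simp)
  omega

/-- **At the home cell the transported plaquette corner is the home corner** (no shift: `¬ Even 0` is false).
[folklore] -/
theorem cornerMap_self (m : ℕ) (v z₀ : Fin 4 → ℤ) (q : PlaqIdx) (x : Fin 4 → ℤ) : cornerMap m v z₀ z₀ q x = x := by
  funext μ
  simp [cornerMap, siteMap, cellMap_self]

/-- Cells of equal parity: the doubled difference of the transports is `3^m (z' - z)`. [folklore] -/
theorem two_mul_cellMap_sub (m : ℕ) (v z₀ t : ℤ) {z z' : ℤ} (hpar : Even (z - z₀) ↔ Even (z' - z₀)) :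
    2 * (cellMap m v z₀ z' t - cellMap m v z₀ z t) = 3 ^ m * z' - 3 ^ m * z := by
  by_cases he : Even (z - z₀)
  · rw [mul_sub, two_mul_cellMap_of_even _ _ _ _ _ he, two_mul_cellMap_of_even _ _ _ _ _ (hpar.1 he)]; ring
  · rw [mul_sub, two_mul_cellMap_of_not_even _ _ _ _ _ he, two_mul_cellMap_of_not_even _ _ _ _ _ (mt hpar.2 he)]
    ring

/-! ## Periodicity -/

/-- **Periodicity**: cell indices congruent mod `N` transport a coordinate to lattice coordinates congruent mod `S`
(`3^m N = 2S`; `N` even keeps the parity of `z - z₀`). [folklore] -/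
theorem cellMap_intCast_congr {m N S : ℕ} (hPN : (3 : ℤ) ^ m * N = 2 * S) (hN : Even N) (v z₀ t : ℤ) {z z' : ℤ}
    (h : (z : ZMod N) = (z' : ZMod N)) : (cellMap m v z₀ z t : ZMod S) = (cellMap m v z₀ z' t : ZMod S) := by
  rw [ZMod.intCast_eq_intCast_iff_dvd_sub] at h ⊢
  obtain ⟨k, hk⟩ := h
  obtain ⟨u, hu⟩ := hN
  have hk' : z' = z + 2 * (u * k) := by
    have : (N : ℤ) = u + u := by exact_mod_cast hu
    linear_combination hk + k * this
  have hpar : Even (z - z₀) ↔ Even (z' - z₀) := by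
    rw [show z' - z₀ = z - z₀ + 2 * (u * k) by rw [hk']; ring]
    exact ⟨fun he => he.add (even_two_mul _), fun he => by simpa using he.sub (even_two_mul (u * k))⟩
  refine ⟨k, ?_⟩
  have h2 := two_mul_cellMap_sub m v z₀ t hpar
  have h3 : (3 : ℤ) ^ m * z' - 3 ^ m * z = 2 * (S * k) := by
    rw [← mul_sub, show z' - z = N * k by linear_combination hk, ← mul_assoc, hPN]; ring
  have h4 : (2 : ℤ) * (cellMap m v z₀ z' t - cellMap m v z₀ z t) = 2 * (S * k) := h2.trans h3
  exact mul_left_cancel₀ two_ne_zero h4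

/-- Parities of `z - z₀` agree for indices congruent mod an even `N`, coordinatewise. [folklore] -/
theorem even_sub_iff_of_intCast_eq {N : ℕ} (hN : Even N) {z z' z₀ : ℤ} (h : (z : ZMod N) = (z' : ZMod N)) :
    (Even (z - z₀) ↔ Even (z' - z₀)) := by
  rw [ZMod.intCast_eq_intCast_iff_dvd_sub] at h
  obtain ⟨k, hk⟩ := h
  obtain ⟨u, hu⟩ := hN
  have hk' : z' - z₀ = z - z₀ + 2 * (u * k) := by
    have : (N : ℤ) = u + u := by exact_mod_cast hu
    linear_combination hk + k * this
  rw [hk']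
  exact ⟨fun he => he.add (even_two_mul _), fun he => by simpa using he.sub (even_two_mul (u * k))⟩

/-- **Periodicity of the transported corner**, coordinatewise mod `S`. [folklore] -/
theorem cornerMap_intCast_congr {m N S : ℕ} (hPN : (3 : ℤ) ^ m * N = 2 * S) (hN : Even N) (v z₀ : Fin 4 → ℤ)
    (q : PlaqIdx) (x : Fin 4 → ℤ) {z z' : Fin 4 → ℤ} (h : ∀ μ, (z μ : ZMod N) = (z' μ : ZMod N)) (μ : Fin 4) :
    (cornerMap m v z₀ z q x μ : ZMod S) = (cornerMap m v z₀ z' q x μ : ZMod S) := by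
  simp only [cornerMap, siteMap, Int.cast_sub, even_sub_iff_of_intCast_eq hN (h μ) (z₀ := z₀ μ)]
  rw [cellMap_intCast_congr hPN hN (v μ) (z₀ μ) (x μ) (h μ)]

/-! ## Reflection covariance -/

/-- **Reflection covariance of the transport** (the dihedral bookkeeping behind the chessboard estimate): for cells
`b, b'` with `b + b' ≡ 2c - 1 (mod N)` — `b'` is the image of `b` under the reflection of the block torus through the
block boundary `c` — the wall reflection `t ↦ (2v + 3^m c) - t` of the corner transported to `b'`, shifted by `-1`
if the axis lies in the plaquette plane (`ip`), is the corner transported to `b`, mod `S`. [folklore] -/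
theorem cellMap_reflect {m N S : ℕ} (hPN : (3 : ℤ) ^ m * N = 2 * S) (hN : Even N) (v z₀ t c : ℤ) {b b' : ℤ}
    (hb : (N : ℤ) ∣ 2 * c - 1 - b - b') (ip : Prop) [Decidable ip] :
    ((2 * v + 3 ^ m * c - (cellMap m v z₀ b' t - if ip ∧ ¬ Even (b' - z₀) then 1 else 0) -
        (if ip then 1 else 0) : ℤ) : ZMod S) =
      ((cellMap m v z₀ b t - if ip ∧ ¬ Even (b - z₀) then 1 else 0 : ℤ) : ZMod S) := by
  rw [ZMod.intCast_eq_intCast_iff_dvd_sub]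
  obtain ⟨k, hk⟩ := hb
  obtain ⟨u, hu⟩ := hN
  have huN : (N : ℤ) = u + u := by exact_mod_cast hu
  -- `b - z₀` and `b' - z₀` have opposite parities
  have hsum : b' - z₀ = -(b - z₀) + (2 * (c - z₀ - u * k) - 1) := by linear_combination -hk - k * huN
  have hodd : Odd (2 * (c - z₀ - u * k) - 1) := ⟨c - z₀ - u * k - 1, by ring⟩
  have hPk : (3 : ℤ) ^ m * (2 * c - 1 - b - b') = 2 * (S * k) := by rw [hk, ← mul_assoc, hPN]; ring
  refine ⟨-k, ?_⟩
  by_cases he : Even (b - z₀)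
  · have he' : ¬ Even (b' - z₀) := by
      rw [hsum, Int.not_even_iff_odd]; exact he.neg.add_odd hodd
    have h1 := two_mul_cellMap_of_even m v z₀ b t he
    have h2 := two_mul_cellMap_of_not_even m v z₀ b' t he'
    simp only [he, he', not_true_eq_false, not_false_eq_true, and_false, and_true, if_false]
    apply mul_left_cancel₀ (two_ne_zero (α := ℤ))
    split_ifs <;> linear_combination h1 + h2 - hPk
  · have he' : Even (b' - z₀) := by
      rw [hsum]; exact (Int.not_even_iff_odd.1 he).neg.add_odd hodd
    have h1 := two_mul_cellMap_of_not_even m v z₀ b t he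
    have h2 := two_mul_cellMap_of_even m v z₀ b' t he'
    simp only [he, he', not_true_eq_false, not_false_eq_true, and_false, and_true, if_false]
    apply mul_left_cancel₀ (two_ne_zero (α := ℤ))
    split_ifs <;> linear_combination h1 + h2 - hPk

/-! ## Bounds: transported core sites stay inside their cell -/

/-- A coordinate two lattice units inside the home cell is transported two lattice units inside the target cell
(doubled walls `2v + 3^m z`, `2v + 3^m (z + 1)`). [folklore] -/
theorem two_mul_cellMap_bounds (m : ℕ) (v z₀ z t : ℤ) (h₁ : 2 * v + 3 ^ m * z₀ + 4 ≤ 2 * t)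
    (h₂ : 2 * t ≤ 2 * v + 3 ^ m * z₀ + 3 ^ m - 4) :
    2 * v + 3 ^ m * z + 4 ≤ 2 * cellMap m v z₀ z t ∧ 2 * cellMap m v z₀ z t ≤ 2 * v + 3 ^ m * z + 3 ^ m - 4 := by
  by_cases he : Even (z - z₀)
  · have h := two_mul_cellMap_of_even m v z₀ z t he
    constructor <;> omega
  · have h := two_mul_cellMap_of_not_even m v z₀ z t he
    constructor <;> omega

/-- The transported plaquette corner (with its in-plane shift `∈ {0, -1}`) in doubled coordinates:
`2v + 3^m z + 2 ≤ 2 · corner ≤ 2v + 3^m (z + 1) - 4`. [folklore] -/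
theorem two_mul_cornerMap_bounds (m : ℕ) (v z₀ z : Fin 4 → ℤ) (q : PlaqIdx) (x : Fin 4 → ℤ) (μ : Fin 4)
    (h₁ : 2 * v μ + 3 ^ m * z₀ μ + 4 ≤ 2 * x μ) (h₂ : 2 * x μ ≤ 2 * v μ + 3 ^ m * z₀ μ + 3 ^ m - 4) :
    2 * v μ + 3 ^ m * z μ + 2 ≤ 2 * cornerMap m v z₀ z q x μ ∧
      2 * cornerMap m v z₀ z q x μ ≤ 2 * v μ + 3 ^ m * z μ + 3 ^ m - 4 := by
  have h := two_mul_cellMap_bounds m (v μ) (z₀ μ) (z μ) (x μ) h₁ h₂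
  simp only [cornerMap, siteMap]
  split_ifs <;> constructor <;> omega

/-- **Positive-half cells transport into the open positive half-slab.** If the cell `b` lies in the positive half of
the block torus for the boundary `c` (`b - c ≡ w (mod N)` with `2w + 2 ≤ N`) and `2Y` lies between the doubled walls
of `b` as in `two_mul_cornerMap_bounds`, then a lift `Y₁ ≡ Y (mod S)` satisfies
`2v + 3^m c + 2 ≤ 2Y₁ ≤ 2v + 3^m c + S - 4`. [folklore] -/
theorem exists_slab_lift {m N S : ℕ} (hPN : (3 : ℤ) ^ m * N = 2 * S) {b c w : ℕ} (hw : 2 * w + 2 ≤ N)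
    (hbcw : (N : ℤ) ∣ (b : ℤ) - c - w) (v : ℤ) {Y : ℤ} (hY₁ : 2 * v + 3 ^ m * b + 2 ≤ 2 * Y)
    (hY₂ : 2 * Y ≤ 2 * v + 3 ^ m * b + 3 ^ m - 4) :
    ∃ Y₁ : ℤ, (Y₁ : ZMod S) = (Y : ZMod S) ∧ 2 * v + 3 ^ m * c + 2 ≤ 2 * Y₁ ∧
      2 * Y₁ + 4 ≤ 2 * v + 3 ^ m * c + S := by
  obtain ⟨k, hk⟩ := hbcw
  refine ⟨Y - S * k, by simp, ?_, ?_⟩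
  · have h1 : (3 : ℤ) ^ m * b - 3 ^ m * c - 3 ^ m * w = 2 * (S * k) := by
      rw [← mul_sub, ← mul_sub, hk, ← mul_assoc, hPN]; ring
    have h2 : (0 : ℤ) ≤ 3 ^ m * w := by positivity
    linarith
  · have h1 : (3 : ℤ) ^ m * b - 3 ^ m * c - 3 ^ m * w = 2 * (S * k) := by
      rw [← mul_sub, ← mul_sub, hk, ← mul_assoc, hPN]; ring
    have h2 : (3 : ℤ) ^ m * (2 * w + 2) ≤ 3 ^ m * N :=
      mul_le_mul_of_nonneg_left (by exact_mod_cast hw) (by positivity)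
    rw [hPN] at h2
    linarith

/-! ## Distinct home cells, core support -/

/-- **Distinct cells of the central half-box are distinct mod `N`**: two home cells of the central half-box
whose indices agree mod `N` in a coordinate agree in that coordinate (`3^m |z - z'| ≤ 2L - 3^m < 3^m N`). [folklore] -/
theorem eq_of_cellInHalfBox_of_intCast_eq {L m N : ℕ} (hPN : (3 : ℤ) ^ m * N = 2 * ((2 * L + 1 : ℕ) : ℤ))
    {v z z' : Fin 4 → ℤ} (hz : CellInHalfBox L m v z) (hz' : CellInHalfBox L m v z') {μ : Fin 4}
    (h : (z μ : ZMod N) = (z' μ : ZMod N)) : z μ = z' μ := by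
  rw [ZMod.intCast_eq_intCast_iff_dvd_sub] at h
  have key : ∀ {w : Fin 4 → ℤ}, CellInHalfBox L m v w →
      -(L : ℤ) ≤ 2 * v μ + 3 ^ m * w μ ∧ 2 * v μ + 3 ^ m * w μ + 3 ^ m ≤ L := by
    intro w hw
    obtain ⟨h1, h2⟩ := hw μ
    simp only [cellSide] at h1 h2
    constructor
    · have h1' : ((-(L : ℤ) : ℤ) : ℝ) ≤ ((2 * v μ + 3 ^ m * w μ : ℤ) : ℝ) := by push_cast; linarith
      exact_mod_cast h1'
    · have h2' : ((2 * v μ + 3 ^ m * w μ + 3 ^ m : ℤ) : ℝ) ≤ ((L : ℤ) : ℝ) := by push_cast; linarith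
      exact_mod_cast h2'
  obtain ⟨h1, h2⟩ := key hz
  obtain ⟨h3, h4⟩ := key hz'
  have hP : (1 : ℤ) ≤ 3 ^ m := one_le_pow₀ (by norm_num)
  have habs : |(3 : ℤ) ^ m * (z' μ - z μ)| < (3 : ℤ) ^ m * N := by
    rw [hPN, abs_lt, mul_sub]; push_cast; constructor <;> linarith
  rw [abs_mul, abs_of_pos (by positivity : (0 : ℤ) < 3 ^ m)] at habs
  have habs' : |z' μ - z μ| < N := lt_of_mul_lt_mul_left habs (by positivity)
  have h0 : z' μ - z μ = 0 := Int.eq_zero_of_abs_lt_dvd h habs'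
  linarith

/-- **Core support in lattice units**: a lattice point of the physical core (`a > 0`) lies two lattice units inside
its cell, in doubled coordinates `2v + 3^m z + 4 ≤ 2x ≤ 2v + 3^m (z + 1) - 4`. [folklore] -/
theorem two_mul_bounds_of_mem_physCore {a : ℝ} (ha : 0 < a) {m : ℕ} {v z x : Fin 4 → ℤ}
    (hx : a • siteToE x ∈ physCore a m v z) (μ : Fin 4) :
    2 * v μ + 3 ^ m * z μ + 4 ≤ 2 * x μ ∧ 2 * x μ ≤ 2 * v μ + 3 ^ m * z μ + 3 ^ m - 4 := by
  obtain ⟨h1, h2⟩ := hx μ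
  simp only [cellSide, PiLp.smul_apply, siteToE_apply, smul_eq_mul] at h1 h2
  have h1' := le_of_mul_le_mul_left h1 ha
  have h2' := le_of_mul_le_mul_left h2 ha
  constructor
  · have h : ((2 * v μ + 3 ^ m * z μ + 4 : ℤ) : ℝ) ≤ ((2 * x μ : ℤ) : ℝ) := by push_cast; linarith
    exact_mod_cast h
  · have h : ((2 * x μ : ℤ) : ℝ) ≤ ((2 * v μ + 3 ^ m * z μ + 3 ^ m - 4 : ℤ) : ℝ) := by push_cast; linarith
    exact_mod_cast h

/-- Anchor of this helper file (registered sub-goal of stmt-QuantumFields-15828, helper of `stub_arrayFunctional`):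
at the home cell the transported plaquette corner is the home corner. [folklore] -/
theorem arrayFunctional_anchor_grid :
    ∀ (m : ℕ) (v z₀ : Fin 4 → ℤ) (q : PlaqIdx) (x : Fin 4 → ℤ), cornerMap m v z₀ z₀ q x = x :=
  cornerMap_self

end Summit.QuantumFields.YangMills.Theorems.ContinuumLegGivenGap

end
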